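import Summits.NavierStokesRegularity.NavierStokesRegularity.Theorems.PerpetualPumpAveragedTypeIBlowupSlavedLadderTools

/-!
# Crux `PerpetualPump.AveragedTypeIBlowup` (stmt-NavierStokesRegularity-1835), line `Sketch`:
# level estimates for the stub `slavedLadder`

This is the second of three files proving the registered stub `stub_slavedLadder` of the line
skeleton `Cruxes/AveragedTypeIBlowup/Lines/Sketch.lean` (G10, Mathlib-only; the ladder of damped
carriers `x_j` and bonds `y_j`, `j ≥ 2`, above the front of the cascade stays in its box). It
proves the four ONE-WINDOW ESTIMATES of a single level `j` used in the bootstrap step.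

Setting of every estimate: the box `|x_j| ≤ A`, `|y_j| ≤ B`, `|y_{j-1}| ≤ Bm`, `|x_{j+1}| ≤ Ap`,
`mx_j ≤ M`, `my_j ≤ M'` holds on `[0, S]`, and on the window `[S, t]` the same quantities exceed
their box by at most `N ∈ [0, 1]`. Then on `[S, t]` each quantity of level `j` exceeds its box by
at most `N Λ κ (σ - S)`, with `Λ` an explicit affine function of the box sizes:

* `slavedLadder_x_step` — the carrier `x' = κ(-x + y_{j-1}²/q³ - y² - εb x y) + e`,
  `|e| ≤ η κ mx`: `|x' + κ x| ≤ κ (A/2 + N Λ)` by the closure inequality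
  `Bm²/q³ + B² + εb A B + η M ≤ A/2`, then the damped max principle from time `S`.
* `slavedLadder_y_step` — the bond `y' = κ(y (x - x₊/q - 1) + εb x²) + e`, written as
  `y' + κ y = κ (y (x - x₊/q) + εb x²) + e` with `|x - x₊/q| ≤ 1/2 + 2N` (`A, Ap ≤ 1/4`,
  `q ≥ 1`) and the closure inequality `εb A² + η M' ≤ B/4`: `|y' + κ y| ≤ κ (3B/4 + N Λ)`.
* `slavedLadder_mx_step`, `slavedLadder_my_step` — the Duhamel majorants
  `m(σ) ≤ m(0) e^{-θκσ} + κ ∫₀^σ e^{-θκ(σ-u)} |bracket(u)| du`: the bracket is `≤ θ M/2` on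
  `[0, S]` and `≤ θ M/2 + N Λ` on `[S, σ]` (closure inequalities divided by `θ`), and the exact
  exponential integrals give `m(σ) ≤ M + N Λ κ (σ - S)`.

## References

Standard ODE comparison / bootstrap arguments (folklore), organised as in T. Tao, *Finite time
blowup for an averaged three-dimensional Navier–Stokes equation*, J. Amer. Math. Soc. 29 (2016),
§5–6.
-/

noncomputable section

-- the summit namespace `…NavierStokesRegularity.NavierStokesRegularity…` is the tree convention
set_option linter.dupNamespace false

open MeasureTheory Set Filter Topology

namespace Summit.NavierStokesRegularity.NavierStokesRegularity.Theorems.PerpetualPumpAveragedTypeIBlowup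

/-- **Carrier, one window.** For the damped carrier
`x' = k(-x + ym²/q³ - y² - εb x y) + e` with `|e| ≤ η k mx`, the closure inequality
`Bm²/q³ + B² + εb A B + η M ≤ A/2`, the box `|x(S)| ≤ A` at time `S` and the `N`-enlarged box on
`[S, t]`, one has `|x(σ)| ≤ A + N Λ k (σ - S)` on `[S, t]`. [folklore] -/
theorem slavedLadder_x_step {xj yj ym mxj exj : ℝ → ℝ}
    {k q εb η A B Bm M N Λ S t σ₁ : ℝ}
    (hq : 1 ≤ q) (hεb : 0 ≤ εb) (hη : 0 ≤ η) (hk : 1 ≤ k) (hB : 0 ≤ B)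
    (hBm : 0 ≤ Bm) (hN0 : 0 ≤ N) (hN1 : N ≤ 1)
    (hΛ : 2 * Bm + 2 * B + 2 + εb * (A + B + 1) + η ≤ Λ)
    (hcl : Bm ^ 2 / q ^ 3 + B ^ 2 + εb * A * B + η * M ≤ A / 2)
    (hS : 0 ≤ S) (hSt : S ≤ t) (ht : t ≤ σ₁)
    (hx : ContinuousOn xj (Icc 0 σ₁))
    (hd : ∀ σ ∈ Ioo 0 σ₁, HasDerivAt xj
      (k * (-(xj σ) + ym σ ^ 2 / q ^ 3 - yj σ ^ 2 - εb * xj σ * yj σ) + exj σ) σ)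
    (he : ∀ σ ∈ Icc 0 σ₁, |exj σ| ≤ η * k * mxj σ)
    (hxS : |xj S| ≤ A)
    (bx : ∀ u ∈ Icc S t, |xj u| ≤ A + N) (by_ : ∀ u ∈ Icc S t, |yj u| ≤ B + N)
    (bym : ∀ u ∈ Icc S t, |ym u| ≤ Bm + N) (bmx : ∀ u ∈ Icc S t, mxj u ≤ M + N) :
    ∀ σ ∈ Icc S t, |xj σ| ≤ A + N * Λ * (k * (σ - S)) := by
  have hk0 : 0 ≤ k := by linarith
  have hA : 0 ≤ A := (abs_nonneg _).trans hxS
  have hΛ0 : 0 ≤ Λ := by nlinarith [mul_nonneg hεb hA, mul_nonneg hεb hB]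
  refine slavedLadder_mode_step (B' := A / 2) (D := N * Λ) hSt hk0
    (hx.mono (Icc_subset_Icc hS ht)) ?_ hxS (by linarith) (mul_nonneg hN0 hΛ0)
  intro σ hσ
  have hσ' : σ ∈ Ioo 0 σ₁ := ⟨hS.trans_lt hσ.1, hσ.2.trans_le ht⟩
  have hσI : σ ∈ Icc S t := Ioo_subset_Icc_self hσ
  refine ⟨_, hd σ hσ', ?_⟩
  have hg := slavedLadder_forcing_x hq hεb hN0 hN1 hBm (bx σ hσI) (by_ σ hσI) (bym σ hσI)
  have hex : |exj σ| ≤ η * k * (M + N) :=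
    (he σ (Ioo_subset_Icc_self hσ')).trans
      (mul_le_mul_of_nonneg_left (bmx σ hσI) (mul_nonneg hη hk0))
  have inner : Bm ^ 2 / q ^ 3 + B ^ 2 + εb * A * B +
      N * (2 * Bm + 2 * B + 2 + εb * (A + B + 1)) + η * (M + N) ≤ A / 2 + N * Λ := by
    have := mul_le_mul_of_nonneg_left hΛ hN0
    linarith
  have e1 : k * (-(xj σ) + ym σ ^ 2 / q ^ 3 - yj σ ^ 2 - εb * xj σ * yj σ) + exj σ + k * xj σ =
      k * (ym σ ^ 2 / q ^ 3 - yj σ ^ 2 - εb * xj σ * yj σ) + exj σ := by ring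
  rw [e1]
  calc |k * (ym σ ^ 2 / q ^ 3 - yj σ ^ 2 - εb * xj σ * yj σ) + exj σ|
      ≤ |k * (ym σ ^ 2 / q ^ 3 - yj σ ^ 2 - εb * xj σ * yj σ)| + |exj σ| := abs_add_le _ _
    _ = k * |ym σ ^ 2 / q ^ 3 - yj σ ^ 2 - εb * xj σ * yj σ| + |exj σ| := by
        rw [abs_mul, abs_of_nonneg hk0]
    _ ≤ k * (Bm ^ 2 / q ^ 3 + B ^ 2 + εb * A * B +
          N * (2 * Bm + 2 * B + 2 + εb * (A + B + 1))) + η * k * (M + N) :=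
        add_le_add (mul_le_mul_of_nonneg_left hg hk0) hex
    _ ≤ k * (A / 2 + N * Λ) := by nlinarith [mul_le_mul_of_nonneg_left inner hk0]

/-- **Bond, one window.** For the bond `y' = k(y (x - x₊/q - 1) + εb x²) + e` with
`|e| ≤ η k my`, `A, Ap ≤ 1/4`, `q ≥ 1`, the closure inequality `εb A² + η M ≤ B/4`, the box
`|y(S)| ≤ B` at time `S` and the `N`-enlarged box on `[S, t]`, one has
`|y(σ)| ≤ B + N Λ k (σ - S)` on `[S, t]` (the rate `x - x₊/q - 1 ≤ -1/2 + 2N` is split as the unit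
damping plus a perturbation of size `≤ 1/2 + 2N`). [folklore] -/
theorem slavedLadder_y_step {xj yj xp myj eyj : ℝ → ℝ}
    {k q εb η A Ap B M N Λ S t σ₁ : ℝ}
    (hq : 1 ≤ q) (hεb : 0 ≤ εb) (hη : 0 ≤ η) (hk : 1 ≤ k) (hA : 0 ≤ A) (hA4 : A ≤ 1 / 4)
    (hAp : 0 ≤ Ap) (hAp4 : Ap ≤ 1 / 4) (hB : 0 ≤ B) (hN0 : 0 ≤ N) (hN1 : N ≤ 1)
    (hΛ : 2 * B + A + Ap + 2 + εb * (2 * A + 1) + η ≤ Λ)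
    (hcl : εb * A ^ 2 + η * M ≤ B / 4)
    (hS : 0 ≤ S) (hSt : S ≤ t) (ht : t ≤ σ₁)
    (hy : ContinuousOn yj (Icc 0 σ₁))
    (hd : ∀ σ ∈ Ioo 0 σ₁, HasDerivAt yj
      (k * (yj σ * (xj σ - xp σ / q - 1) + εb * xj σ ^ 2) + eyj σ) σ)
    (he : ∀ σ ∈ Icc 0 σ₁, |eyj σ| ≤ η * k * myj σ)
    (hyS : |yj S| ≤ B)
    (bx : ∀ u ∈ Icc S t, |xj u| ≤ A + N) (bxp : ∀ u ∈ Icc S t, |xp u| ≤ Ap + N)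
    (by_ : ∀ u ∈ Icc S t, |yj u| ≤ B + N) (bmy : ∀ u ∈ Icc S t, myj u ≤ M + N) :
    ∀ σ ∈ Icc S t, |yj σ| ≤ B + N * Λ * (k * (σ - S)) := by
  have hk0 : 0 ≤ k := by linarith
  have hΛ0 : 0 ≤ Λ := by nlinarith [mul_nonneg hεb hA]
  refine slavedLadder_mode_step (B' := 3 * B / 4) (D := N * Λ) hSt hk0
    (hy.mono (Icc_subset_Icc hS ht)) ?_ hyS (by linarith) (mul_nonneg hN0 hΛ0)
  intro σ hσ
  have hσ' : σ ∈ Ioo 0 σ₁ := ⟨hS.trans_lt hσ.1, hσ.2.trans_le ht⟩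
  have hσI : σ ∈ Icc S t := Ioo_subset_Icc_self hσ
  refine ⟨_, hd σ hσ', ?_⟩
  have hg := slavedLadder_forcing_y (εb := εb) hq hεb hN0 hN1 hAp hB (bx σ hσI) (bxp σ hσI)
    (by_ σ hσI)
  have hex : |eyj σ| ≤ η * k * (M + N) :=
    (he σ (Ioo_subset_Icc_self hσ')).trans
      (mul_le_mul_of_nonneg_left (bmy σ hσI) (mul_nonneg hη hk0))
  have hrate : A + Ap / q ≤ 1 / 2 := by
    have := div_le_self hAp hq
    linarith
  have hBA : B * (A + Ap / q) ≤ B * (1 / 2) := mul_le_mul_of_nonneg_left hrate hB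
  have inner : B * (A + Ap / q) + εb * A ^ 2 +
      N * (2 * B + A + Ap + 2 + εb * (2 * A + 1)) + η * (M + N) ≤ 3 * B / 4 + N * Λ := by
    have := mul_le_mul_of_nonneg_left hΛ hN0
    linarith
  have e1 : k * (yj σ * (xj σ - xp σ / q - 1) + εb * xj σ ^ 2) + eyj σ + k * yj σ =
      k * (yj σ * (xj σ - xp σ / q) + εb * xj σ ^ 2) + eyj σ := by ring
  rw [e1]
  calc |k * (yj σ * (xj σ - xp σ / q) + εb * xj σ ^ 2) + eyj σ|
      ≤ |k * (yj σ * (xj σ - xp σ / q) + εb * xj σ ^ 2)| + |eyj σ| := abs_add_le _ _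
    _ = k * |yj σ * (xj σ - xp σ / q) + εb * xj σ ^ 2| + |eyj σ| := by
        rw [abs_mul, abs_of_nonneg hk0]
    _ ≤ k * (B * (A + Ap / q) + εb * A ^ 2 +
          N * (2 * B + A + Ap + 2 + εb * (2 * A + 1))) + η * k * (M + N) :=
        add_le_add (mul_le_mul_of_nonneg_left hg hk0) hex
    _ ≤ k * (3 * B / 4 + N * Λ) := by nlinarith [mul_le_mul_of_nonneg_left inner hk0]

/-- **Carrier majorant, one window.** For the Duhamel majorant
`mx(σ) ≤ mx(0) e^{-θkσ} + k ∫₀^σ e^{-θk(σ-u)} |ym²/q³ - y² - εb x y| du` with `mx(0) ≤ M`, the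
closure inequality `(Bm²/q³ + B² + εb A B)/θ ≤ M/2`, the box on `[0, S]` and the `N`-enlarged box
on `[S, σ]`, one has `mx(σ) ≤ M + N Λ k (σ - S)`. [folklore] -/
theorem slavedLadder_mx_step {xj yj ym mxj : ℝ → ℝ}
    {k q εb θ A B Bm M N Λ S σ σ₁ : ℝ}
    (hq : 1 ≤ q) (hεb : 0 ≤ εb) (hθ : 0 < θ) (hk : 1 ≤ k) (hBm : 0 ≤ Bm)
    (hM : 0 ≤ M) (hN0 : 0 ≤ N) (hN1 : N ≤ 1)
    (hΛ : 2 * Bm + 2 * B + 2 + εb * (A + B + 1) ≤ Λ)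
    (hcl : (Bm ^ 2 / q ^ 3 + B ^ 2 + εb * A * B) / θ ≤ M / 2)
    (hS : 0 ≤ S) (hSσ : S ≤ σ) (hσ : σ ≤ σ₁)
    (hx : ContinuousOn xj (Icc 0 σ₁)) (hy : ContinuousOn yj (Icc 0 σ₁))
    (hym : ContinuousOn ym (Icc 0 σ₁))
    (hm : mxj σ ≤ mxj 0 * Real.exp (-(θ * k * σ)) +
      k * ∫ u in (0 : ℝ)..σ, Real.exp (-(θ * k * (σ - u))) *
        |ym u ^ 2 / q ^ 3 - yj u ^ 2 - εb * xj u * yj u|)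
    (hm0M : mxj 0 ≤ M)
    (b0x : ∀ u ∈ Icc 0 S, |xj u| ≤ A) (b0y : ∀ u ∈ Icc 0 S, |yj u| ≤ B)
    (b0ym : ∀ u ∈ Icc 0 S, |ym u| ≤ Bm)
    (bx : ∀ u ∈ Icc S σ, |xj u| ≤ A + N) (by_ : ∀ u ∈ Icc S σ, |yj u| ≤ B + N)
    (bym : ∀ u ∈ Icc S σ, |ym u| ≤ Bm + N) :
    mxj σ ≤ M + N * Λ * (k * (σ - S)) := by
  have hk0 : 0 ≤ k := by linarith
  have hc : Bm ^ 2 / q ^ 3 + B ^ 2 + εb * A * B ≤ M / 2 * θ := (div_le_iff₀ hθ).1 hcl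
  have hh : ContinuousOn (fun u => |ym u ^ 2 / q ^ 3 - yj u ^ 2 - εb * xj u * yj u|)
      (Icc 0 σ) := by
    have hsub : Icc 0 σ ⊆ Icc 0 σ₁ := Icc_subset_Icc_right hσ
    have hx' := hx.mono hsub
    have hy' := hy.mono hsub
    have hym' := hym.mono hsub
    fun_prop
  have h1 : ∀ u ∈ Icc 0 S, |ym u ^ 2 / q ^ 3 - yj u ^ 2 - εb * xj u * yj u| ≤
      Bm ^ 2 / q ^ 3 + B ^ 2 + εb * A * B := by
    intro u hu
    have := slavedLadder_forcing_x (ν := 0) (εb := εb) hq hεb le_rfl zero_le_one hBm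
      ((b0x u hu).trans (le_add_of_nonneg_right le_rfl))
      ((b0y u hu).trans (le_add_of_nonneg_right le_rfl))
      ((b0ym u hu).trans (le_add_of_nonneg_right le_rfl))
    linarith
  have h2 : ∀ u ∈ Icc S σ, |ym u ^ 2 / q ^ 3 - yj u ^ 2 - εb * xj u * yj u| ≤
      Bm ^ 2 / q ^ 3 + B ^ 2 + εb * A * B + N * Λ := by
    intro u hu
    have := slavedLadder_forcing_x (εb := εb) hq hεb hN0 hN1 hBm (bx u hu) (by_ u hu) (bym u hu)
    have h' := mul_le_mul_of_nonneg_left hΛ hN0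
    linarith
  have hkc : k * (Bm ^ 2 / q ^ 3 + B ^ 2 + εb * A * B) ≤ θ * k * M := by
    nlinarith [mul_le_mul_of_nonneg_left hc hk0, mul_nonneg (mul_nonneg hθ.le hk0) hM]
  have hΛ0 : 0 ≤ N * Λ := by
    have hA : 0 ≤ A := (abs_nonneg _).trans (b0x 0 (left_mem_Icc.2 hS))
    have hB : 0 ≤ B := (abs_nonneg _).trans (b0y 0 (left_mem_Icc.2 hS))
    exact mul_nonneg hN0 (by nlinarith [mul_nonneg hεb hA, mul_nonneg hεb hB])
  have key := slavedLadder_majorant_step (h := fun u =>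
      |ym u ^ 2 / q ^ 3 - yj u ^ 2 - εb * xj u * yj u|) (m0 := mxj 0)
    (mul_pos hθ (by linarith)) hk0 hS hSσ hh h1 h2 hΛ0 hkc hm0M
  have e : M + k * (N * Λ) * (σ - S) = M + N * Λ * (k * (σ - S)) := by ring
  linarith

/-- **Bond majorant, one window.** For the Duhamel majorant
`my(σ) ≤ my(0) e^{-θkσ} + k ∫₀^σ e^{-θk(σ-u)} |y (x - x₊/q) + εb x²| du` with `my(0) ≤ M`, the
closure inequality `(B (A + Ap/q + 1) + εb A²)/θ ≤ M/2`, the box on `[0, S]` and the `N`-enlarged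
box on `[S, σ]`, one has `my(σ) ≤ M + N Λ k (σ - S)`. [folklore] -/
theorem slavedLadder_my_step {xj yj xp myj : ℝ → ℝ}
    {k q εb θ A Ap B M N Λ S σ σ₁ : ℝ}
    (hq : 1 ≤ q) (hεb : 0 ≤ εb) (hθ : 0 < θ) (hk : 1 ≤ k) (hAp : 0 ≤ Ap) (hB : 0 ≤ B)
    (hM : 0 ≤ M) (hN0 : 0 ≤ N) (hN1 : N ≤ 1)
    (hΛ : 2 * B + A + Ap + 2 + εb * (2 * A + 1) ≤ Λ)
    (hcl : (B * (A + Ap / q + 1) + εb * A ^ 2) / θ ≤ M / 2)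
    (hS : 0 ≤ S) (hSσ : S ≤ σ) (hσ : σ ≤ σ₁)
    (hx : ContinuousOn xj (Icc 0 σ₁)) (hy : ContinuousOn yj (Icc 0 σ₁))
    (hxp : ContinuousOn xp (Icc 0 σ₁))
    (hm : myj σ ≤ myj 0 * Real.exp (-(θ * k * σ)) +
      k * ∫ u in (0 : ℝ)..σ, Real.exp (-(θ * k * (σ - u))) *
        |yj u * (xj u - xp u / q) + εb * xj u ^ 2|)
    (hm0M : myj 0 ≤ M)
    (b0x : ∀ u ∈ Icc 0 S, |xj u| ≤ A) (b0xp : ∀ u ∈ Icc 0 S, |xp u| ≤ Ap)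
    (b0y : ∀ u ∈ Icc 0 S, |yj u| ≤ B)
    (bx : ∀ u ∈ Icc S σ, |xj u| ≤ A + N) (bxp : ∀ u ∈ Icc S σ, |xp u| ≤ Ap + N)
    (by_ : ∀ u ∈ Icc S σ, |yj u| ≤ B + N) :
    myj σ ≤ M + N * Λ * (k * (σ - S)) := by
  have hk0 : 0 ≤ k := by linarith
  have hc : B * (A + Ap / q) + εb * A ^ 2 ≤ M / 2 * θ := by
    have h1 : B * (A + Ap / q + 1) + εb * A ^ 2 ≤ M / 2 * θ := (div_le_iff₀ hθ).1 hcl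
    nlinarith
  have hh : ContinuousOn (fun u => |yj u * (xj u - xp u / q) + εb * xj u ^ 2|) (Icc 0 σ) := by
    have hsub : Icc 0 σ ⊆ Icc 0 σ₁ := Icc_subset_Icc_right hσ
    have hx' := hx.mono hsub
    have hy' := hy.mono hsub
    have hxp' := hxp.mono hsub
    fun_prop
  have h1 : ∀ u ∈ Icc 0 S, |yj u * (xj u - xp u / q) + εb * xj u ^ 2| ≤
      B * (A + Ap / q) + εb * A ^ 2 := by
    intro u hu
    have := slavedLadder_forcing_y (ν := 0) (εb := εb) hq hεb le_rfl zero_le_one hAp hB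
      ((b0x u hu).trans (le_add_of_nonneg_right le_rfl))
      ((b0xp u hu).trans (le_add_of_nonneg_right le_rfl))
      ((b0y u hu).trans (le_add_of_nonneg_right le_rfl))
    linarith
  have h2 : ∀ u ∈ Icc S σ, |yj u * (xj u - xp u / q) + εb * xj u ^ 2| ≤
      B * (A + Ap / q) + εb * A ^ 2 + N * Λ := by
    intro u hu
    have := slavedLadder_forcing_y (εb := εb) hq hεb hN0 hN1 hAp hB (bx u hu) (bxp u hu)
      (by_ u hu)
    have h' := mul_le_mul_of_nonneg_left hΛ hN0
    linarith
  have hkc : k * (B * (A + Ap / q) + εb * A ^ 2) ≤ θ * k * M := by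
    nlinarith [mul_le_mul_of_nonneg_left hc hk0, mul_nonneg (mul_nonneg hθ.le hk0) hM]
  have hΛ0 : 0 ≤ N * Λ := by
    have hA : 0 ≤ A := (abs_nonneg _).trans (b0x 0 (left_mem_Icc.2 hS))
    exact mul_nonneg hN0 (by nlinarith [mul_nonneg hεb hA])
  have key := slavedLadder_majorant_step (h := fun u =>
      |yj u * (xj u - xp u / q) + εb * xj u ^ 2|) (m0 := myj 0)
    (mul_pos hθ (by linarith)) hk0 hS hSσ hh h1 h2 hΛ0 hkc hm0M
  have e : M + k * (N * Λ) * (σ - S) = M + N * Λ * (k * (σ - S)) := by ring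
  linarith

/-- **Registered stub `stub_slavedLadderSteps`** (level estimates for the stub `slavedLadder`,
line `Sketch` of crux `PerpetualPump.AveragedTypeIBlowup`, stmt-NavierStokesRegularity-1835): the
one-window estimate for a carrier (`slavedLadder_x_step`) and for its Duhamel majorant
(`slavedLadder_mx_step`). [folklore] -/
theorem stub_slavedLadderSteps :
    (∀ (xj yj ym mxj exj : ℝ → ℝ) (k q εb η A B Bm M N Λ S t σ₁ : ℝ),
      1 ≤ q → 0 ≤ εb → 0 ≤ η → 1 ≤ k → 0 ≤ B → 0 ≤ Bm → 0 ≤ N → N ≤ 1 →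
      2 * Bm + 2 * B + 2 + εb * (A + B + 1) + η ≤ Λ →
      Bm ^ 2 / q ^ 3 + B ^ 2 + εb * A * B + η * M ≤ A / 2 →
      0 ≤ S → S ≤ t → t ≤ σ₁ → ContinuousOn xj (Icc 0 σ₁) →
      (∀ σ ∈ Ioo 0 σ₁, HasDerivAt xj
        (k * (-(xj σ) + ym σ ^ 2 / q ^ 3 - yj σ ^ 2 - εb * xj σ * yj σ) + exj σ) σ) →
      (∀ σ ∈ Icc 0 σ₁, |exj σ| ≤ η * k * mxj σ) → |xj S| ≤ A →
      (∀ u ∈ Icc S t, |xj u| ≤ A + N) → (∀ u ∈ Icc S t, |yj u| ≤ B + N) →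
      (∀ u ∈ Icc S t, |ym u| ≤ Bm + N) → (∀ u ∈ Icc S t, mxj u ≤ M + N) →
      ∀ σ ∈ Icc S t, |xj σ| ≤ A + N * Λ * (k * (σ - S))) ∧
    (∀ (xj yj ym mxj : ℝ → ℝ) (k q εb θ A B Bm M N Λ S σ σ₁ : ℝ),
      1 ≤ q → 0 ≤ εb → 0 < θ → 1 ≤ k → 0 ≤ Bm → 0 ≤ M → 0 ≤ N → N ≤ 1 →
      2 * Bm + 2 * B + 2 + εb * (A + B + 1) ≤ Λ →
      (Bm ^ 2 / q ^ 3 + B ^ 2 + εb * A * B) / θ ≤ M / 2 →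
      0 ≤ S → S ≤ σ → σ ≤ σ₁ →
      ContinuousOn xj (Icc 0 σ₁) → ContinuousOn yj (Icc 0 σ₁) → ContinuousOn ym (Icc 0 σ₁) →
      (mxj σ ≤ mxj 0 * Real.exp (-(θ * k * σ)) +
        k * ∫ u in (0 : ℝ)..σ, Real.exp (-(θ * k * (σ - u))) *
          |ym u ^ 2 / q ^ 3 - yj u ^ 2 - εb * xj u * yj u|) →
      mxj 0 ≤ M →
      (∀ u ∈ Icc 0 S, |xj u| ≤ A) → (∀ u ∈ Icc 0 S, |yj u| ≤ B) →
      (∀ u ∈ Icc 0 S, |ym u| ≤ Bm) →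
      (∀ u ∈ Icc S σ, |xj u| ≤ A + N) → (∀ u ∈ Icc S σ, |yj u| ≤ B + N) →
      (∀ u ∈ Icc S σ, |ym u| ≤ Bm + N) →
      mxj σ ≤ M + N * Λ * (k * (σ - S))) :=
  ⟨fun _ _ _ _ _ _ _ _ _ _ _ _ _ _ _ _ _ _ => slavedLadder_x_step,
    fun _ _ _ _ _ _ _ _ _ _ _ _ _ _ _ _ _ => slavedLadder_mx_step⟩

end Summit.NavierStokesRegularity.NavierStokesRegularity.Theorems.PerpetualPumpAveragedTypeIBlowup

end
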